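import Literature.AlgebraicGeometry.Motives.GoodReductionSpecialFibreProofs
import Literature.AlgebraicGeometry.Morphisms.SteinFactorization
import HarnessLib

/-!
# Good reduction: the special fibre is geometrically irreducible — the conditional discharges
(Stein factorisation, Tag 03H2 / Tag 0AY8)

This file is the former last section (`namespace Literature.AlgebraicGeometry.Motives.IntegralModel`,
"The special fibre of a smooth proper model") of
`Literature/AlgebraicGeometry/Motives/GoodReductionSpecialFibreProofs.lean`, moved here VERBATIM
(same fully-qualified names, same statements and proofs; refactor item wi-25961, cone repair R2 of
route HodgeConjecture/GaloisSieve): it is the only part of that development which takes the two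
named facts of `Literature/AlgebraicGeometry/Morphisms/SteinFactorization.lean`
(`steinFactorization_geometricallyConnected`, `geometricallyConnected_towards_normal`) as
hypotheses, so after the move the importers of `GoodReductionSpecialFibreProofs.lean` (smooth ⇒
reduced / integral local rings, generic fibre, `hasPotentialGoodReductionAt_holds`) that do not
otherwise import `SteinFactorization.lean` — all thirteen but
`Resolution/AlterationsFibrationReductionSection.lean`, which reaches it through
`AlterationsFibresConnected.lean` and uses it — no longer carry those two unproved facts in their
import cone. Nothing outside this file uses the six theorems below.

## Content (see the module docstring of `GoodReductionSpecialFibreProofs.lean` for the whole proof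
plan, steps 1–5, and the references)

For a smooth proper model `𝒳 → Spec 𝓞_{K,v}` of a smooth projective geometrically irreducible
`X/K`:

* `IntegralModel.geometricallyConnected_total_hom (hStein : steinFactorization_geometricallyConnected)`
  — Zariski's connectedness for the model (step 3: `𝓞_{K,v}` is integrally closed in `Γ(𝒳, 𝒪)`,
  `isIso_fromNormalization_of_genericFibre`, so the Stein factorisation is trivial);
* `IntegralModel.towardsNormal_hypotheses` — the elementary hypotheses of Tag 0AY8 for
  `𝒳 → Spec 𝓞_{K,v}` (step 5), and `geometricallyConnected_total_hom_of_towardsNormal`;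
* the conditional discharges of
  `Literature.AlgebraicGeometry.Motives.IntegralModel.geometricallyIrreducible_reductionAt`:
  `geometricallyIrreducible_reductionAt_of_towardsNormal`, `…_of_stacks0AY8`
  (from `geometricallyConnected_towards_normal`, Tag 0AY8 as printed) and `…_of_stein` (from
  `steinFactorization_geometricallyConnected`, Tag 03H2), through step 4
  (`geometricallyIrreducible_of_geometricallyConnected_of_smoothOfRelativeDimension`).

The unconditional `geometricallyIrreducible_reductionAt_holds` lives in
`Literature/AlgebraicGeometry/Motives/GoodReductionZariskiProofs.lean`; these conditional forms are
kept as the record of the printed route (Stacks Project, Tags 0E0N, 056T, 03H2, 0AY8).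

## References

* The Stacks Project, Tags 03H2, 0AY8 (More on Morphisms, Theorem 37.53.5, Lemma 37.53.6), 0E0N,
  054Q, 056S, 056T, 03HV.
* R. Hartshorne, *Algebraic Geometry* (1977), III.11.3.
* J.-P. Serre, J. Tate, *Good reduction of abelian varieties*, Ann. of Math. 88 (1968), §1.
-/

noncomputable section

open CategoryTheory AlgebraicGeometry Limits PrimeSpectrum Polynomial TensorProduct

universe u

/-! ### The special fibre of a smooth proper model -/

namespace Literature.AlgebraicGeometry.Motives.IntegralModel

open scoped NumberField

open IsDedekindDomain IsDedekindDomain.HeightOneSpectrum Morphisms Resolution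

variable {K : Type} [Field K] [NumberField K] {v : HeightOneSpectrum (𝓞 K)} {X : SchemeOver K}
  (𝒳 : IntegralModel (valuationSubringAtPrime K v) K X)

/-- **Zariski's connectedness theorem for a smooth proper model** (conditional on Stein
factorisation, Stacks Project, Tag 03H2): if `X/K` is smooth projective and geometrically
irreducible and `𝒳 → Spec 𝓞_{K,v}` is a smooth proper model, then `𝒳 → Spec 𝓞_{K,v}` has
geometrically connected fibres. Indeed `𝓞_{K,v}` is integrally closed in `Γ(𝒳, 𝒪)` (checked on
the generic fibre `𝒳_K ≅ X`, which is integral — smooth hence reduced, and geometrically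
irreducible — so that `K` is integrally closed in `Γ(X, 𝒪_X)`), whence the Stein factorisation of
`𝒳 → Spec 𝓞_{K,v}` is trivial. [cite: StacksProject, Tag 03H2 (More on Morphisms, Theorem 37.53.5)] -/
theorem geometricallyConnected_total_hom (hStein : steinFactorization_geometricallyConnected.{0})
    {n : ℕ} (hX : IsSmoothProjective n X) (h : 𝒳.IsSmoothProper n) :
    GeometricallyConnected 𝒳.total.hom := by
  haveI := h.1
  haveI := h.2
  haveI : Smooth 𝒳.total.hom := SmoothOfRelativeDimension.smooth n _
  haveI := smoothOfRelativeDimension_isStableUnderBaseChange (n := n)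
  set i : Spec (.of K) ⟶ Spec (.of (valuationSubringAtPrime K v)) :=
    Spec.map (CommRingCat.ofHom (algebraMap (valuationSubringAtPrime K v) K)) with hi
  -- the generic fibre `𝒳_K ≅ X` is smooth and geometrically irreducible over `K`, hence integral
  have hgK : pullback.snd 𝒳.total.hom i = 𝒳.genericIso.hom.left ≫ X.hom :=
    (Over.w 𝒳.genericIso.hom).symm
  haveI : @IsIso _ _ (pullback 𝒳.total.hom i) X.left 𝒳.genericIso.hom.left :=
    inferInstanceAs (IsIso ((Over.forget _).mapIso 𝒳.genericIso).hom)
  haveI : GeometricallyIrreducible (pullback.snd 𝒳.total.hom i) := by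
    rw [hgK]
    exact MorphismProperty.RespectsIso.precomp (P := @GeometricallyIrreducible) _ _
      hX.geometricallyIrreducible
  haveI : IrreducibleSpace ↥(pullback 𝒳.total.hom i) :=
    GeometricallyIrreducible.irreducibleSpace_of_subsingleton (f := pullback.snd 𝒳.total.hom i)
  haveI : SmoothOfRelativeDimension n (pullback.snd 𝒳.total.hom i) :=
    MorphismProperty.pullback_snd _ _ ‹_›
  haveI : IsReduced (pullback 𝒳.total.hom i) :=
    isReduced_of_smoothOfRelativeDimension (pullback.snd 𝒳.total.hom i) n
  haveI : IsIntegral (pullback 𝒳.total.hom i) := isIntegral_of_irreducibleSpace_of_isReduced _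
  -- so `𝓞_{K,v}` is integrally closed in `Γ(𝒳, 𝒪)` and Stein factorisation applies
  haveI : IsIso 𝒳.total.hom.fromNormalization :=
    isIso_fromNormalization_of_genericFibre (K := K) 𝒳.total.hom fun b hb ↦
      mem_range_of_isIntegralElem_of_geometricallyIrreducible _ b hb
  exact hStein.of_isIso_fromNormalization 𝒳.total.hom

/-- **The hypotheses of Tag 0AY8 for a smooth proper model.** Let `X/K` be smooth projective and
geometrically irreducible and `𝒳 → S = Spec 𝓞_{K,v}` a smooth proper model. Then, numbering as in
the Stacks Project, Tag 0AY8 (More on Morphisms, Lemma 37.53.6): (3) `S` is normal (`𝓞_{K,v}` is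
a discrete valuation ring; `isIntegrallyClosed_stalk_Spec`); (4) `𝒳` is reduced — the generic
fibre `𝒳_K ≅ X` is reduced (smooth over `K`, `isReduced_of_smoothOfRelativeDimension`) and
`𝒳_K → 𝒳` is scheme-theoretically dominant (`𝒳 → S` flat; Mathlib
`IsSchemeTheoreticallyDominant.isReduced`); (5) the generic points of the irreducible components
of `𝒳` lie over the generic point `ξ` (`𝒳 → S` flat, `apply_eq_genericPoint_of_flat`);
(6) `H⁰(𝒳_ξ, 𝒪) = κ(ξ)`: `K → Γ(𝒳_K, 𝒪)` is injective and surjective, since every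
global section of the proper `K`-scheme `𝒳_K` is integral over `K` (Mathlib
`isIntegral_appTop_of_universallyClosed`) and `K` is integrally closed in `Γ(𝒳_K, 𝒪)`
(`mem_range_of_isIntegralElem_of_geometricallyIrreducible`: `𝒳_K` is integral and geometrically
irreducible, `K` perfect), transported to the fibre over `ξ` by
`isIso_appTop_fiberToSpecResidueField_genericPoint`. ((1) properness and (2) integrality of `S`
are instances.) [cite: StacksProject, Tag 0AY8 (More on Morphisms, Lemma 37.53.6), hypotheses (3)–(6)] -/
theorem towardsNormal_hypotheses {n : ℕ} (hX : IsSmoothProjective n X) (h : 𝒳.IsSmoothProper n) :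
    (∀ s : ↥(Spec (CommRingCat.of (valuationSubringAtPrime K v))),
        IsIntegrallyClosed
          ((Spec (CommRingCat.of (valuationSubringAtPrime K v))).presheaf.stalk s)) ∧
      IsReduced 𝒳.total.left ∧
      (∀ x ∈ genericPoints ↥𝒳.total.left,
        𝒳.total.hom.base x =
          genericPoint ↥(Spec (CommRingCat.of (valuationSubringAtPrime K v)))) ∧
      IsIso (𝒳.total.hom.fiberToSpecResidueField
        (genericPoint ↥(Spec (CommRingCat.of (valuationSubringAtPrime K v))))).appTop := by
  haveI := h.1
  haveI := h.2
  haveI : Smooth 𝒳.total.hom := SmoothOfRelativeDimension.smooth n _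
  haveI := smoothOfRelativeDimension_isStableUnderBaseChange (n := n)
  set i : Spec (.of K) ⟶ Spec (.of (valuationSubringAtPrime K v)) :=
    Spec.map (CommRingCat.ofHom (algebraMap (valuationSubringAtPrime K v) K)) with hi
  -- the generic fibre `𝒳_K ≅ X` is smooth and geometrically irreducible over `K`, hence integral
  have hgK : pullback.snd 𝒳.total.hom i = 𝒳.genericIso.hom.left ≫ X.hom :=
    (Over.w 𝒳.genericIso.hom).symm
  haveI : @IsIso _ _ (pullback 𝒳.total.hom i) X.left 𝒳.genericIso.hom.left :=
    inferInstanceAs (IsIso ((Over.forget _).mapIso 𝒳.genericIso).hom)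
  haveI : GeometricallyIrreducible (pullback.snd 𝒳.total.hom i) := by
    rw [hgK]
    exact MorphismProperty.RespectsIso.precomp (P := @GeometricallyIrreducible) _ _
      hX.geometricallyIrreducible
  haveI : IrreducibleSpace ↥(pullback 𝒳.total.hom i) :=
    GeometricallyIrreducible.irreducibleSpace_of_subsingleton (f := pullback.snd 𝒳.total.hom i)
  haveI : SmoothOfRelativeDimension n (pullback.snd 𝒳.total.hom i) :=
    MorphismProperty.pullback_snd _ _ ‹_›
  haveI : IsReduced (pullback 𝒳.total.hom i) :=
    isReduced_of_smoothOfRelativeDimension (pullback.snd 𝒳.total.hom i) n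
  haveI : IsIntegral (pullback 𝒳.total.hom i) := isIntegral_of_irreducibleSpace_of_isReduced _
  -- (4) `𝒳` is reduced: `𝒳_K → 𝒳` is scheme-theoretically dominant with reduced source
  haveI : IsSchemeTheoreticallyDominant i :=
    isSchemeTheoreticallyDominant_SpecMap _ (IsFractionRing.injective (valuationSubringAtPrime K v) K)
  have h4 : IsReduced 𝒳.total.left :=
    IsSchemeTheoreticallyDominant.isReduced (pullback.fst 𝒳.total.hom i)
  -- (6) `K → Γ(𝒳_K, 𝒪)` is bijective
  have h6K : IsIso (pullback.snd 𝒳.total.hom i).appTop := by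
    set gK := pullback.snd 𝒳.total.hom i
    set eK := Scheme.ΓSpecIso (.of K)
    have hγ : Function.Injective gK.appTop.hom := by
      haveI : Nonempty ↥(⊤ : (pullback 𝒳.total.hom i).Opens) := ⟨⟨Classical.arbitrary _, trivial⟩⟩
      have h := (gK.appTop.hom.comp eK.inv.hom).injective
      exact (Function.Injective.of_comp_iff' _
        eK.symm.commRingCatIsoToRingEquiv.bijective).mp h
    have hsurj : Function.Surjective gK.appTop.hom := by
      intro b
      have hint : (eK.inv ≫ gK.appTop).hom.IsIntegralElem b := by
        have h1 : gK.appTop.hom.IsIntegralElem b := isIntegral_appTop_of_universallyClosed gK b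
        obtain ⟨p, hp, hpb⟩ := h1
        refine ⟨p.map eK.hom.hom, hp.map _, ?_⟩
        rw [Polynomial.eval₂_map]
        convert hpb using 2
        ext x
        simp
      obtain ⟨c, hc⟩ := mem_range_of_isIntegralElem_of_geometricallyIrreducible _ b hint
      exact ⟨eK.inv c, hc⟩
    exact (ConcreteCategory.isIso_iff_bijective _).mpr ⟨hγ, hsurj⟩
  refine ⟨fun s ↦ isIntegrallyClosed_stalk_Spec _ s, h4,
    fun x hx ↦ apply_eq_genericPoint_of_flat _ x hx,
    isIso_appTop_fiberToSpecResidueField_genericPoint (K := K) _ h6K⟩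

/-- **Zariski's connectedness theorem for a smooth proper model**, conditional on the Stacks
Project, Tag 0AY8 in its locally Noetherian form (the hypothesis `h0AY8` is Tag 0AY8 restricted to
locally Noetherian bases, spelled out; it is implied by the named fact
`Literature.AlgebraicGeometry.Morphisms.geometricallyConnected_towards_normal` of
`Literature/AlgebraicGeometry/Morphisms/SteinFactorization.lean`): if `X/K` is smooth
projective and geometrically irreducible and `𝒳 → Spec 𝓞_{K,v}` is a smooth proper model, then
`𝒳 → Spec 𝓞_{K,v}` has geometrically connected fibres — all hypotheses of Tag 0AY8 hold by
`towardsNormal_hypotheses`. [cite: StacksProject, Tag 0AY8 (More on Morphisms, Lemma 37.53.6)] -/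
theorem geometricallyConnected_total_hom_of_towardsNormal
    (h0AY8 : ∀ ⦃Y S : Scheme.{0}⦄ (f : Y ⟶ S) [IsProper f] [IsLocallyNoetherian S] [IsIntegral S]
      (_hS : ∀ s : S, IsIntegrallyClosed (S.presheaf.stalk s)) [IsReduced Y]
      (_hY : ∀ x ∈ genericPoints Y, f.base x = genericPoint S)
      (_hξ : IsIso (f.fiberToSpecResidueField (genericPoint S)).appTop),
      (∀ U : S.Opens, IsIso (f.app U)) ∧ GeometricallyConnected f)
    {n : ℕ} (hX : IsSmoothProjective n X) (h : 𝒳.IsSmoothProper n) :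
    GeometricallyConnected 𝒳.total.hom := by
  haveI := h.2
  obtain ⟨h3, h4, h5, h6⟩ := 𝒳.towardsNormal_hypotheses hX h
  haveI := h4
  exact (h0AY8 𝒳.total.hom h3 h5 h6).2

/-- **Conditional discharge of `geometricallyIrreducible_reductionAt` from Tag 0AY8.** Granting
the Stacks Project, Tag 0AY8 (More on Morphisms, Lemma 37.53.6) over locally Noetherian bases —
the hypothesis is Tag 0AY8 restricted to locally Noetherian bases, spelled out (a consequence of
Stein factorisation in the Noetherian form Tag 03H0, implied by the named fact
`Literature.AlgebraicGeometry.Morphisms.geometricallyConnected_towards_normal`, and weaker than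
Tag 03H2 used by `geometricallyIrreducible_reductionAt_of_stein`) — the reduction `𝒳 ×_{𝓞_{K,v}} κ(v)` of a smooth
proper model `𝒳` of a smooth projective geometrically irreducible `X/K` is geometrically
irreducible: geometrically connected by `geometricallyConnected_total_hom_of_towardsNormal` and
base change, and smooth over `κ(v)`, hence geometrically irreducible
(`geometricallyIrreducible_of_geometricallyConnected_of_smoothOfRelativeDimension`; Stacks Project,
Tags 0E0N, 056T). [cite: StacksProject, Tags 0AY8 and 056T (More on Morphisms, Lemma 37.53.6; Varieties, Lemma 33.25.4)] -/
theorem geometricallyIrreducible_reductionAt_of_towardsNormal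
    (h0AY8 : ∀ ⦃Y S : Scheme.{0}⦄ (f : Y ⟶ S) [IsProper f] [IsLocallyNoetherian S] [IsIntegral S]
      (_hS : ∀ s : S, IsIntegrallyClosed (S.presheaf.stalk s)) [IsReduced Y]
      (_hY : ∀ x ∈ genericPoints Y, f.base x = genericPoint S)
      (_hξ : IsIso (f.fiberToSpecResidueField (genericPoint S)).appTop),
      (∀ U : S.Opens, IsIso (f.app U)) ∧ GeometricallyConnected f) :
    𝒳.geometricallyIrreducible_reductionAt := by
  intro n hX h
  haveI := 𝒳.geometricallyConnected_total_hom_of_towardsNormal h0AY8 hX h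
  haveI := h.1
  haveI := smoothOfRelativeDimension_isStableUnderBaseChange (n := n)
  haveI : SmoothOfRelativeDimension n
      (pullback.snd 𝒳.total.hom (Spec.map (CommRingCat.ofHom (residueAt v)))) :=
    MorphismProperty.pullback_snd _ _ ‹_›
  exact geometricallyIrreducible_of_geometricallyConnected_of_smoothOfRelativeDimension
    (pullback.snd 𝒳.total.hom (Spec.map (CommRingCat.ofHom (residueAt v)))) n

/-- **Conditional discharge of `geometricallyIrreducible_reductionAt` from the named fact**
`Literature.AlgebraicGeometry.Morphisms.geometricallyConnected_towards_normal` (Stacks Project, Tag 0AY8 =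
More on Morphisms, Lemma 37.53.6, as printed: arbitrary base): the named form of
`geometricallyIrreducible_reductionAt_of_towardsNormal`, whose spelled-out hypothesis is the
locally Noetherian case of the fact. (The unconditional `geometricallyIrreducible_reductionAt_holds`
is proved in `Literature/AlgebraicGeometry/Motives/GoodReductionZariskiProofs.lean`.)
[cite: StacksProject, Tags 0AY8 and 056T (More on Morphisms, Lemma 37.53.6; Varieties, Lemma 33.25.4)] -/
theorem geometricallyIrreducible_reductionAt_of_stacks0AY8
    (h0AY8 : geometricallyConnected_towards_normal.{0}) :
    𝒳.geometricallyIrreducible_reductionAt :=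
  𝒳.geometricallyIrreducible_reductionAt_of_towardsNormal fun _ _ f _ _ _ hS _ hY hξ ↦ h0AY8 f hS hY hξ

/-- **Conditional discharge of `geometricallyIrreducible_reductionAt`.** Granting Stein
factorisation (Stacks Project, Tag 03H2, the named fact `steinFactorization_geometricallyConnected`),
the reduction `𝒳 ×_{𝓞_{K,v}} κ(v)` of a smooth proper model `𝒳` of a smooth projective
geometrically irreducible `X/K` is geometrically irreducible: it is geometrically connected by
`geometricallyConnected_total_hom` and base change, and smooth of relative dimension `n` over
`κ(v)`, hence geometrically irreducible by
`geometricallyIrreducible_of_geometricallyConnected_of_smoothOfRelativeDimension` (Stacks Project,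
Tags 0E0N, 056T; SGA 1 X 1.2). [cite: StacksProject, Tags 03H2 and 056T (Stein factorisation; smooth + geometrically connected ⇒ geometrically irreducible)] -/
theorem geometricallyIrreducible_reductionAt_of_stein
    (hStein : steinFactorization_geometricallyConnected.{0}) :
    𝒳.geometricallyIrreducible_reductionAt := by
  intro n hX h
  haveI := 𝒳.geometricallyConnected_total_hom hStein hX h
  haveI := h.1
  haveI := smoothOfRelativeDimension_isStableUnderBaseChange (n := n)
  haveI : SmoothOfRelativeDimension n
      (pullback.snd 𝒳.total.hom (Spec.map (CommRingCat.ofHom (residueAt v)))) :=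
    MorphismProperty.pullback_snd _ _ ‹_›
  exact geometricallyIrreducible_of_geometricallyConnected_of_smoothOfRelativeDimension
    (pullback.snd 𝒳.total.hom (Spec.map (CommRingCat.ofHom (residueAt v)))) n

end Literature.AlgebraicGeometry.Motives.IntegralModel

end
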